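/-
Copyright: statement-level skeleton of a published paper (lit-balaban cell, Phase-2 proof seat p19, gen 2). No claims beyond
what the kernel checks below.
-/
import Mathlib
import Literature.AlgebraicTopology.CellComplexes.CubicalTorusHomology
import Literature.MathematicalPhysics.QuantumFieldTheory.Balaban1983to89.B3Ineq215DecaySum
import Literature.MathematicalPhysics.QuantumFieldTheory.Balaban1983to89.B3Ineq215Degrees

/-!
# B3 — T. Bałaban, *(Higgs)₂,₃ quantum fields in a finite volume. III. Renormalization*, CMP **88** (1983) 411–445
[Balaban1983Higgs3] — Sect. 2, p. 427: re-routing the exponential factors through the shrunk line and the summation over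
`Δ(v′)`, PROVED

statement-level skeleton of published theorems with citation tags; proofs where landed; nothing here is a claim about
the Yang–Mills mass gap

PDF held: `paper:balaban1983-higgs-2-3-quantum-fields-finite-volume` (journal page = PDF page + 410); displays read on
the ×2 renders `pub-balaban/b2b-balaban-ref1/pages/1983-cmp88-higgs23-III/1983-cmp88-higgs23-III-p014 … p018-x2.png`
(pp. 424–428).

Part of the Phase-2 proof of SKELETON rows **B3.Eq2.15-2.16** (unit `lit-balaban-p19` gen 2, HOME
`run/shared/lean/pub/lit-balaban/`): files `B3Ineq215CubeGeometry` → `B3Ineq215DecaySum`, `B3Ineq215Quotient` →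
`B3Ineq215Degrees` → `B3Ineq215Reroute` → `B3Ineq215Step` → `B3Ineq215Proof` (the theorem `Model.ineq215`), all in the
sub-namespace `…Balaban1983to89.B3Ineq215`; the rows were typed by r15 in `B3Sect2FirstEstimate`.

WHAT IS REPRODUCED (steps (i)–(ii) of the shrinking step (2.15′)/(2.16) p. 427–428, for a fixed assignment `j ∈ J(l̃)`,
stage `i → i+1`, in Prop. 2.2 generality on the concrete cubes).  (i) p. 427: *"We represent the exponential factor for
the line l(1) as a product of as many equal factors as there are legs in v′ (now by a leg we mean a leg of some line of
the graph). These factors combined with the exponential factors of the lines l′ give us the factors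
exp[−δ₂(L^{j_{l′}}η)^{−1}dist(Δ(v), Δ(v″))], where v″ is a second vertex of the line l′"* — `reroute` (triangle inequality
through `Δ(v′)`), `lineF_succ_le` (per line `l′`), `EXP_succ_le` (all lines; `δ_{i+1} = δ_i/(2m+1)`, at most `2m` legs in
`v′`, constant `e^{δ₀}`).  (ii) p. 427: *"We have still one exponential exp[−δ₂(L^jη)^{−1}dist(Δ(v), Δ(v′))] for the line l
and we use it to make the summation over Δ(v′)"* — `sum_bt_le` (Fubini in the coordinate `Δ(b_t)` — the landed
`Literature.AlgebraicTopology.CellComplexes.CubicalTorus.sum_piFinset_update` — and `Cube.sum_exp_distI_le`).  *"In the case v = v′"* (a loop of `G/G_i`) the same lemmas apply with the leftover factor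
equal to `1`.  Steps (iii)–(iv) and the step inequality `step216` are in `B3Ineq215Step`.
-/

open Finset

namespace Literature.MathematicalPhysics.QuantumFieldTheory.Balaban1983to89.B3Ineq215

namespace Model

variable {V : Type} [Fintype V] [DecidableEq V] {m : ℕ} (M : Model V m)

/-! ## Elementary facts about the decay rates and the factors -/

/-- `δ_i > 0`. [cite: Balaban1983Higgs3, (2.16) p.428] -/
theorem δAt_pos (i : ℕ) : 0 < M.δAt i := by
  unfold δAt; have := M.δ₀_pos; positivity

/-- `δ_i = (2m+1) δ_{i+1}`. [cite: Balaban1983Higgs3, (2.16) p.428] -/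
theorem δAt_succ (i : ℕ) : M.δAt i = (2 * m + 1) * M.δAt (i + 1) := by
  unfold δAt; rw [pow_succ]; field_simp

/-- `δ_{i+1} ≤ δ_i`. [cite: Balaban1983Higgs3, (2.16) p.428] -/
theorem δAt_succ_le (i : ℕ) : M.δAt (i + 1) ≤ M.δAt i := by
  rw [M.δAt_succ i]
  have := M.δAt_pos (i + 1)
  have hm : (1 : ℝ) ≤ 2 * m + 1 := by
    have : (0 : ℝ) ≤ (m : ℝ) := Nat.cast_nonneg m
    linarith
  nlinarith

/-- `δ_i ≤ δ₀`. [cite: Balaban1983Higgs3, (2.16) p.428] -/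
theorem δAt_le_δ₀ (i : ℕ) : M.δAt i ≤ M.δ₀ := by
  induction i with
  | zero => simp [δAt]
  | succ n ih => exact (M.δAt_succ_le n).trans ih

/-- Line factors are positive. [cite: Balaban1983Higgs3, (2.14) p.427] -/
theorem lineF_pos (i : ℕ) (j : Fin m → ℕ) (Θ : V → Cube M.d) (l : Fin m) : 0 < M.lineF i j Θ l := Real.exp_pos _

/-- Line factors are `≤ 1`. [cite: Balaban1983Higgs3, (2.14) p.427] -/
theorem lineF_le_one (i : ℕ) (j : Fin m → ℕ) (Θ : V → Cube M.d) (l : Fin m) : M.lineF i j Θ l ≤ 1 := by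
  unfold lineF
  rw [Real.exp_le_one_iff, neg_nonpos]
  have := M.δAt_pos i
  have := M.L_pos_real
  positivity

/-- `EXP > 0`. [cite: Balaban1983Higgs3, (2.14) p.427] -/
theorem EXP_pos (i : ℕ) (j : Fin m → ℕ) (Θ : V → Cube M.d) : 0 < M.EXP i j Θ :=
  Finset.prod_pos fun l _ => M.lineF_pos i j Θ l

/-- `VF > 0`. [cite: Balaban1983Higgs3, (2.14) p.427] -/
theorem VF_pos (i k : ℕ) (j : Fin m → ℕ) : 0 < M.VF i k j :=
  Finset.prod_pos fun _ _ => Real.rpow_pos_of_pos (M.sc_pos k _) _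

/-- `LP > 0`. [cite: Balaban1983Higgs3, (2.14) p.427] -/
theorem LP_pos (i k : ℕ) (j : Fin m → ℕ) : 0 < M.LP i k j :=
  Finset.prod_pos fun _ _ => Real.rpow_pos_of_pos (M.sc_pos k _) _

/-- `W = VF · LP · Σ_{{Δ}} EXP`. [cite: Balaban1983Higgs3, (2.14) p.427] -/
theorem W_eq (i k : ℕ) (j : Fin m → ℕ) (box : V → Fin M.d → ℕ) :
    M.W i k j box = M.VF i k j * M.LP i k j * ∑ Θ ∈ M.Locs i k j box, M.EXP i j Θ := by
  unfold W; rw [Finset.mul_sum]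

/-- `W ≥ 0`. [cite: Balaban1983Higgs3, (2.14) p.427] -/
theorem W_nonneg (i k : ℕ) (j : Fin m → ℕ) (box : V → Fin M.d → ℕ) : 0 ≤ M.W i k j box := by
  rw [M.W_eq]
  exact mul_nonneg (mul_nonneg (M.VF_pos i k j).le (M.LP_pos i k j).le)
    (Finset.sum_nonneg fun Θ _ => (M.EXP_pos i j Θ).le)

/-- `EXP` depends on `Θ` only through its values at the vertices of `G/G_i`. [cite: Balaban1983Higgs3, (2.14) p.427] -/
theorem EXP_congr (i : ℕ) (j : Fin m → ℕ) {Θ Θ' : V → Cube M.d} (hΘ : ∀ b, M.rep i b = b → Θ b = Θ' b) :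
    M.EXP i j Θ = M.EXP i j Θ' := by
  refine Finset.prod_congr rfl fun l _ => ?_
  unfold lineF
  rw [hΘ _ (M.rep_idem i _), hΘ _ (M.rep_idem i _)]

/-- Scales of the localizations: a vertex `b` of `G/G_i` is localized in a cube of side `L^{j(b)}η`.
[cite: Balaban1983Higgs3, (2.14) p.426] -/
theorem s_of_mem_Locs {i k : ℕ} {j : Fin m → ℕ} {box : V → Fin M.d → ℕ} {Θ : V → Cube M.d}
    (hΘ : Θ ∈ M.Locs i k j box) {b : V} (hb : M.rep i b = b) : (Θ b).s = M.low i b j k := by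
  have hmem := (Fintype.mem_piFinset.1 hΘ) b
  unfold locF at hmem
  rw [if_pos hb] at hmem
  exact Cube.s_of_mem_desc M.L_pos hmem

/-! ## (i) Re-routing the exponential factors through the shrunk line -/

section Step

variable {i : ℕ} (h : i < m)

/-- `exp[+δ_{i+1} (L^tη)^{−1} dist(Δ(b_s), Δ(b_t))]`, the inverse of one of the `2m+1` equal factors into which the
exponential factor of l(i+1) is split (p. 427). [cite: Balaban1983Higgs3, (2.15) p.427] -/
noncomputable def Ebig (j : Fin m → ℕ) (Θ : V → Cube M.d) : ℝ :=
  Real.exp (M.δAt (i + 1) * (Cube.distI M.L (Θ (M.bs i h)) (Θ (M.bt i h)) : ℝ) / (M.L : ℝ) ^ j ⟨i, h⟩)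

/-- The number of legs of the line `l` of `G/G_i` in the vertex `b_t` (0, 1 or 2). [cite: Balaban1983Higgs3, (2.15) p.427] -/
def cnt (l : Fin m) : ℕ :=
  (if M.rep i (M.src l) = M.bt i h then 1 else 0) + (if M.rep i (M.tgt l) = M.bt i h then 1 else 0)

/-- `cnt ≤ 2`. [cite: Balaban1983Higgs3, (2.15) p.427] -/
theorem cnt_le_two (l : Fin m) : M.cnt h l ≤ 2 := by
  unfold cnt; split_ifs <;> omega

variable {j : Fin m → ℕ} {k : ℕ} (hj : Monotone j) (hjk : ∀ l, j l < k)

include hj in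
/-- The geometric re-routing (p. 427): for a line `l′` of index `u ≥ t` and any cube `X`,
`dist(Δ(b_s), X)/L^u ≤ dist(Δ(b_t), X)/L^u + 1 + dist(Δ(b_s), Δ(b_t))/L^t` (triangle inequality through `Δ(b_t)`, whose
side is `L^t ≤ L^u`). [cite: Balaban1983Higgs3, (2.15) p.427] -/
theorem reroute {Θ : V → Cube M.d} (ht : (Θ (M.bt i h)).s = j ⟨i, h⟩) {l : Fin m} (hl : l ∈ remLines m (i + 1))
    (X : Cube M.d) :
    (Cube.distI M.L (Θ (M.bs i h)) X : ℝ) / (M.L : ℝ) ^ j l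
      ≤ (Cube.distI M.L (Θ (M.bt i h)) X : ℝ) / (M.L : ℝ) ^ j l + 1
        + (Cube.distI M.L (Θ (M.bs i h)) (Θ (M.bt i h)) : ℝ) / (M.L : ℝ) ^ j ⟨i, h⟩ := by
  have hL := M.L_pos_real
  have hu : j ⟨i, h⟩ ≤ j l := hj (Fin.le_iff_val_le_val.2 (by have := mem_remLines.1 hl; simp only; omega))
  have hLu : (0 : ℝ) < (M.L : ℝ) ^ j l := by positivity
  have hLt : (0 : ℝ) < (M.L : ℝ) ^ j ⟨i, h⟩ := by positivity
  have htri := Cube.distI_triangle (L := M.L) (Θ (M.bs i h)) (Θ (M.bt i h)) X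
  rw [ht] at htri
  have htri' : (Cube.distI M.L (Θ (M.bs i h)) X : ℝ)
      ≤ (Cube.distI M.L (Θ (M.bs i h)) (Θ (M.bt i h)) : ℝ) + (M.L : ℝ) ^ j ⟨i, h⟩
        + (Cube.distI M.L (Θ (M.bt i h)) X : ℝ) := by exact_mod_cast htri
  have hpow : (M.L : ℝ) ^ j ⟨i, h⟩ ≤ (M.L : ℝ) ^ j l := pow_le_pow_right₀ M.one_lt_L.le hu
  have h1 : (Cube.distI M.L (Θ (M.bs i h)) (Θ (M.bt i h)) : ℝ) / (M.L : ℝ) ^ j l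
      ≤ (Cube.distI M.L (Θ (M.bs i h)) (Θ (M.bt i h)) : ℝ) / (M.L : ℝ) ^ j ⟨i, h⟩ :=
    div_le_div_of_nonneg_left (by positivity) hLt hpow
  have h2 : (M.L : ℝ) ^ j ⟨i, h⟩ / (M.L : ℝ) ^ j l ≤ 1 := (div_le_one hLu).2 hpow
  calc (Cube.distI M.L (Θ (M.bs i h)) X : ℝ) / (M.L : ℝ) ^ j l
      ≤ ((Cube.distI M.L (Θ (M.bs i h)) (Θ (M.bt i h)) : ℝ) + (M.L : ℝ) ^ j ⟨i, h⟩
          + (Cube.distI M.L (Θ (M.bt i h)) X : ℝ)) / (M.L : ℝ) ^ j l := div_le_div_of_nonneg_right htri' hLu.le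
    _ = (Cube.distI M.L (Θ (M.bs i h)) (Θ (M.bt i h)) : ℝ) / (M.L : ℝ) ^ j l
          + (M.L : ℝ) ^ j ⟨i, h⟩ / (M.L : ℝ) ^ j l + (Cube.distI M.L (Θ (M.bt i h)) X : ℝ) / (M.L : ℝ) ^ j l := by
        ring
    _ ≤ _ := by linarith

include hj in
/-- p. 427, per line: the exponential factor of a line `l′` of `G/G_i` (`l′ ≠ l(i+1)`) at rate `δ_i` is bounded by its
factor in `G/G_{i+1}` (legs in `b_t` re-attached to `b_s`) at rate `δ_{i+1}`, times one factor
`e^{δ_{i+1}} exp[δ_{i+1}(L^tη)^{−1}dist(Δ(b_s), Δ(b_t))]` per leg of `l′` in `b_t`. [cite: Balaban1983Higgs3, (2.15) p.427] -/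
theorem lineF_succ_le {Θ : V → Cube M.d} (ht : (Θ (M.bt i h)).s = j ⟨i, h⟩) {l : Fin m}
    (hl : l ∈ remLines m (i + 1)) :
    M.lineF i j Θ l ≤ (Real.exp (M.δAt (i + 1)) * M.Ebig h j Θ) ^ M.cnt h l * M.lineF (i + 1) j Θ l := by
  have hL := M.L_pos_real
  have hδ' := M.δAt_pos (i + 1)
  set δ' := M.δAt (i + 1) with hδ'def
  set Dst : ℝ := (Cube.distI M.L (Θ (M.bs i h)) (Θ (M.bt i h)) : ℝ) / (M.L : ℝ) ^ j ⟨i, h⟩ with hDst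
  have hDst0 : 0 ≤ Dst := by positivity
  -- the distances over L^{j l}, old and new endpoints
  set c₁ := M.rep i (M.src l) with hc₁
  set c₂ := M.rep i (M.tgt l) with hc₂
  have hnew₁ : M.rep (i + 1) (M.src l) = M.rho i h c₁ := M.rep_succ h _
  have hnew₂ : M.rep (i + 1) (M.tgt l) = M.rho i h c₂ := M.rep_succ h _
  set Dq : V → V → ℝ := fun x y => (Cube.distI M.L (Θ x) (Θ y) : ℝ) / (M.L : ℝ) ^ j l with hDq
  have hDq0 : ∀ x y, 0 ≤ Dq x y := fun x y => by positivity
  -- step 1: δ_i ≥ δ_{i+1}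
  have hstep1 : M.lineF i j Θ l ≤ Real.exp (-(δ' * Dq c₁ c₂)) := by
    unfold lineF
    rw [Real.exp_le_exp]
    have : δ' * Dq c₁ c₂ ≤ M.δAt i * Dq c₁ c₂ := mul_le_mul_of_nonneg_right (M.δAt_succ_le i) (hDq0 _ _)
    have e : M.δAt i * (Cube.distI M.L (Θ (M.rep i (M.src l))) (Θ (M.rep i (M.tgt l))) : ℝ) / (M.L : ℝ) ^ j l
        = M.δAt i * Dq c₁ c₂ := by simp only [hDq, hc₁, hc₂]; ring
    rw [e]; linarith
  -- step 2: the key inequality Dq(ρ c₁)(ρ c₂) ≤ Dq c₁ c₂ + cnt · (1 + Dst)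
  have hkey : Dq (M.rho i h c₁) (M.rho i h c₂) ≤ Dq c₁ c₂ + (M.cnt h l : ℝ) * (1 + Dst) := by
    have hR1 : ∀ X : Cube M.d, (Cube.distI M.L (Θ (M.bs i h)) X : ℝ) / (M.L : ℝ) ^ j l
        ≤ (Cube.distI M.L (Θ (M.bt i h)) X : ℝ) / (M.L : ℝ) ^ j l + 1 + Dst := fun X => M.reroute h hj ht hl X
    have hcnt : (M.cnt h l : ℝ) = (if c₁ = M.bt i h then 1 else 0) + (if c₂ = M.bt i h then 1 else 0) := by
      simp only [cnt, hc₁, hc₂]; push_cast; split_ifs <;> simp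
    rw [hcnt]
    by_cases h1 : c₁ = M.bt i h <;> by_cases h2 : c₂ = M.bt i h
    · -- both legs in b_t: the new factor is exp 0 = 1
      rw [if_pos h1, if_pos h2, h1, h2, M.rho_bt h]
      have : Dq (M.bs i h) (M.bs i h) = 0 := by simp [hDq, Cube.distI_self]
      rw [this]
      nlinarith [hDq0 (M.bt i h) (M.bt i h)]
    · rw [if_pos h1, if_neg h2, h1, M.rho_bt h, M.rho_of_ne h h2]
      have := hR1 (Θ c₂)
      simp only [hDq]
      linarith
    · rw [if_neg h1, if_pos h2, h2, M.rho_bt h, M.rho_of_ne h h1]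
      have := hR1 (Θ c₁)
      simp only [hDq]
      rw [Cube.distI_comm (Θ c₁) (Θ (M.bs i h)), Cube.distI_comm (Θ c₁) (Θ (M.bt i h))]
      linarith
    · rw [if_neg h1, if_neg h2, M.rho_of_ne h h1, M.rho_of_ne h h2]
      linarith
  -- step 3: exponentiate
  have hrhs : (Real.exp δ' * M.Ebig h j Θ) ^ M.cnt h l * M.lineF (i + 1) j Θ l
      = Real.exp ((M.cnt h l : ℝ) * (δ' + δ' * Dst) - δ' * Dq (M.rho i h c₁) (M.rho i h c₂)) := by
    unfold lineF Ebig
    rw [hnew₁, hnew₂, ← Real.exp_add, ← Real.exp_nat_mul, ← Real.exp_add]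
    congr 1
    simp only [hDq, hDst, hδ'def]
    ring
  rw [hrhs]
  refine hstep1.trans (Real.exp_le_exp.2 ?_)
  have := mul_le_mul_of_nonneg_left hkey hδ'.le
  nlinarith [this]

include hj in
/-- p. 427–428, all lines at once: the exponential factors of `G/G_i` at rate `δ_i` are bounded by `e^{δ₀}` times the
leftover decay `exp[−δ_{i+1}(L^tη)^{−1}dist(Δ(b_s), Δ(b_t))]` of the shrunk line times the exponential factors of
`G/G_{i+1}` at rate `δ_{i+1}` (the `≤ 2m` legs in `b_t` use up at most `2m` of the `2m+1` equal pieces of the factor of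
l(i+1)). [cite: Balaban1983Higgs3, (2.16) p.428] -/
theorem EXP_succ_le {Θ : V → Cube M.d} (ht : (Θ (M.bt i h)).s = j ⟨i, h⟩) :
    M.EXP i j Θ ≤ Real.exp M.δ₀ * (M.Ebig h j Θ)⁻¹ * M.EXP (i + 1) j Θ := by
  have hδ' := M.δAt_pos (i + 1)
  set δ' := M.δAt (i + 1) with hδ'def
  have hE1 : 1 ≤ M.Ebig h j Θ := by
    unfold Ebig; rw [← hδ'def]
    exact Real.one_le_exp (by have := M.L_pos_real; positivity)
  have hE0 : 0 < M.Ebig h j Θ := lt_of_lt_of_le one_pos hE1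
  -- split off the line l(i+1)
  unfold EXP
  rw [remLines_eq_insert h, Finset.prod_insert (not_mem_remLines_succ h)]
  -- the other lines
  have hrest : ∏ l ∈ remLines m (i + 1), M.lineF i j Θ l
      ≤ ∏ l ∈ remLines m (i + 1), (Real.exp δ' * M.Ebig h j Θ) ^ M.cnt h l * M.lineF (i + 1) j Θ l :=
    Finset.prod_le_prod (fun l _ => (M.lineF_pos i j Θ l).le) fun l hl => M.lineF_succ_le h hj ht hl
  rw [Finset.prod_mul_distrib, Finset.prod_pow_eq_pow_sum] at hrest
  set p := ∑ l ∈ remLines m (i + 1), M.cnt h l with hp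
  have hp_le : p ≤ 2 * m := by
    calc p ≤ ∑ _l ∈ remLines m (i + 1), 2 := Finset.sum_le_sum fun l _ => M.cnt_le_two h l
      _ = 2 * (remLines m (i + 1)).card := by rw [Finset.sum_const, smul_eq_mul, mul_comm]
      _ ≤ 2 * m := Nat.mul_le_mul_left _ (card_remLines_le _)
  -- the factor of l(i+1) itself: exp(−δ_i D/L^t) = Ebig^{−(2m+1)}
  have hl0 : M.lineF i j Θ ⟨i, h⟩ = ((M.Ebig h j Θ) ^ (2 * m + 1))⁻¹ := by
    unfold lineF Ebig
    rw [← Real.exp_nat_mul, ← Real.exp_neg]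
    congr 1
    rw [M.δAt_succ i]
    simp only [bs, bt]
    push_cast
    ring
  rw [hl0]
  have hA : 0 ≤ ∏ l ∈ remLines m (i + 1), M.lineF (i + 1) j Θ l :=
    Finset.prod_nonneg fun l _ => (M.lineF_pos (i + 1) j Θ l).le
  calc ((M.Ebig h j Θ) ^ (2 * m + 1))⁻¹ * ∏ l ∈ remLines m (i + 1), M.lineF i j Θ l
      ≤ ((M.Ebig h j Θ) ^ (2 * m + 1))⁻¹ *
          ((Real.exp δ' * M.Ebig h j Θ) ^ p * ∏ l ∈ remLines m (i + 1), M.lineF (i + 1) j Θ l) :=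
        mul_le_mul_of_nonneg_left hrest (by positivity)
    _ = (Real.exp δ' ^ p * ((M.Ebig h j Θ) ^ p * ((M.Ebig h j Θ) ^ (2 * m + 1))⁻¹)) *
          ∏ l ∈ remLines m (i + 1), M.lineF (i + 1) j Θ l := by rw [mul_pow]; ring
    _ ≤ (Real.exp M.δ₀ * (M.Ebig h j Θ)⁻¹) * ∏ l ∈ remLines m (i + 1), M.lineF (i + 1) j Θ l := by
        refine mul_le_mul_of_nonneg_right ?_ hA
        have h1 : Real.exp δ' ^ p ≤ Real.exp M.δ₀ := by
          rw [← Real.exp_nat_mul]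
          refine Real.exp_le_exp.2 ?_
          calc (p : ℝ) * δ' ≤ (2 * m : ℕ) * δ' := by
                exact mul_le_mul_of_nonneg_right (by exact_mod_cast hp_le) hδ'.le
            _ ≤ (2 * m + 1) * δ' := by push_cast; nlinarith
            _ = M.δAt i := (M.δAt_succ i).symm
            _ ≤ M.δ₀ := M.δAt_le_δ₀ i
        have h2 : (M.Ebig h j Θ) ^ p * ((M.Ebig h j Θ) ^ (2 * m + 1))⁻¹ ≤ (M.Ebig h j Θ)⁻¹ := by
          rw [← zpow_natCast, ← zpow_natCast, ← zpow_neg, ← zpow_add₀ hE0.ne', ← zpow_neg_one]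
          refine zpow_le_zpow_right₀ hE1 ?_
          push_cast; omega
        exact mul_le_mul h1 h2 (by positivity) (Real.exp_pos _).le

/-! ## (ii) The summation over `Δ(b_t)` -/

/-- The leftover decay factor of the shrunk line. [cite: Balaban1983Higgs3, (2.15) p.427] -/
theorem Ebig_inv_eq (j : Fin m → ℕ) (Θ : V → Cube M.d) :
    (M.Ebig h j Θ)⁻¹ = Real.exp (-(M.δAt (i + 1) * (Cube.distI M.L (Θ (M.bs i h)) (Θ (M.bt i h)) : ℝ)
      / (M.L : ℝ) ^ j ⟨i, h⟩)) := by
  unfold Ebig; rw [← Real.exp_neg]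

include hj hjk in
/-- p. 427: *"We have still one exponential exp[−δ₂(L^jη)^{−1}dist(Δ(v), Δ(v′))] for the line l and we use it to make the
summation over Δ(v′). We get some constant O(1) depending on δ₁ and n̄ only"* — Fubini in the coordinate `b_t` (two
different blocks) and the same-scale decay sum: the sum over all localizations of `G/G_i` is at most `K(δ_{i+1}, d)` times
the sum over the localizations with `b_t` frozen at its unit cube. [cite: Balaban1983Higgs3, (2.15) p.427] -/
theorem sum_bt_le (hne : M.bs i h ≠ M.bt i h) (box : V → Fin M.d → ℕ) :
    ∑ Θ ∈ M.Locs i k j box, (M.Ebig h j Θ)⁻¹ * M.EXP (i + 1) j Θ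
      ≤ Cube.Kdec (M.δAt (i + 1)) M.d *
        ∑ w ∈ Fintype.piFinset (Function.update (M.locF i k j box) (M.bt i h) {M.unit k box (M.bt i h)}),
          M.EXP (i + 1) j w := by
  set t := j ⟨i, h⟩ with htdef
  set F' := Function.update (M.locF i k j box) (M.bt i h) {M.unit k box (M.bt i h)} with hF'
  have hF'bt : F' (M.bt i h) = {M.unit k box (M.bt i h)} := by simp [hF']
  have hlocbt : M.locF i k j box (M.bt i h) = Cube.desc M.L (M.unit k box (M.bt i h)) t := by
    unfold locF; rw [if_pos (M.rep_bt h), M.low_bt h hj hjk]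
  have hLocs : M.Locs i k j box = Fintype.piFinset (Function.update F' (M.bt i h)
      (Cube.desc M.L (M.unit k box (M.bt i h)) t)) := by
    unfold Locs; congr 1
    rw [hF', Function.update_idem, ← hlocbt, Function.update_eq_self]
  rw [hLocs, ← Literature.AlgebraicTopology.CellComplexes.CubicalTorus.sum_piFinset_update F' (M.bt i h) hF'bt, Finset.mul_sum]
  refine Finset.sum_le_sum fun w hw => ?_
  -- the scale of w b_s is t
  have hws : (w (M.bs i h)).s = t := by
    have hmem := (Fintype.mem_piFinset.1 hw) (M.bs i h)
    rw [hF', Function.update_of_ne hne] at hmem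
    unfold locF at hmem
    rw [if_pos (M.rep_bs h), M.low_bs h hj hjk] at hmem
    exact Cube.s_of_mem_desc M.L_pos hmem
  -- the integrand does not depend on the b_t coordinate except through the decay factor
  have hcongr : ∀ B : Cube M.d,
      (M.Ebig h j (Function.update w (M.bt i h) B))⁻¹ * M.EXP (i + 1) j (Function.update w (M.bt i h) B)
        = Real.exp (-(M.δAt (i + 1) * (Cube.distI M.L (w (M.bs i h)) B : ℝ) / (M.L : ℝ) ^ (w (M.bs i h)).s))
          * M.EXP (i + 1) j w := by
    intro B
    rw [M.Ebig_inv_eq h j, Function.update_self, Function.update_of_ne hne, hws]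
    congr 1
    refine M.EXP_congr (i + 1) j fun b hb => ?_
    have hbt : b ≠ M.bt i h := by
      intro e; rw [e, M.rep_succ_bt h] at hb; exact hne hb
    rw [Function.update_of_ne hbt]
  simp_rw [hcongr]
  rw [← Finset.sum_mul]
  refine mul_le_mul_of_nonneg_right ?_ (M.EXP_pos (i + 1) j w).le
  refine Cube.sum_exp_distI_le M.d_pos M.L_pos (M.δAt_pos (i + 1)) (w (M.bs i h)) _ fun B hB => ?_
  rw [hws]; exact Cube.s_of_mem_desc M.L_pos hB

end Step

end Model

end Literature.MathematicalPhysics.QuantumFieldTheory.Balaban1983to89.B3Ineq215
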